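import Summits.BirchSwinnertonDyer.BirchSwinnertonDyer.Theorems.SignedLowerHalvesSmallImageLowerHalfBothSignsRttD2J2DeltaCoh
import Summits.BirchSwinnertonDyer.BirchSwinnertonDyer.Theorems.SignedLowerHalvesSmallImageLowerHalfBothSignsRttD2J2DeltaTower
import Literature.NumberTheory.GaloisRepresentations.ContinuousShapiroOpenCoinducedLayerChange
import HarnessLib

/-!
# Route `SignedLowerHalves`, crux L `SmallImageLowerHalfBothSigns` (stmt-BirchSwinnertonDyer-23599), line `rtt_w3` v15 — E2, junction row J2,
# research half «δ₁», brick (δ-d2): SHAPIRO DICTIONARY for the `𝒪`-coefficient level groups `H^i(G_S(F), 𝒪 ⊗ μ_{p^k} ⊗ θ)` of [JLK] Def. 4.2 —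
# `relCoresO` / `levelConjO` / `levelMapHomO` ARE the transported fibre sum / right translation / coefficient map of the permutation model

INPUTS hand `bsd-inputs-honda-p1` g24 under LEAD `cruxlead-stmt-BirchSwinnertonDyer-23599` g11 (v15.1, stub B row J2). The `𝒪`-twin of the cf2 lane's
`ImaginaryQuadraticMainConjectureCarriersShapiro` (ℤ_p coefficients), WITHOUT the Ш-condition transport: honda g22's level groups `levelCohO S P θ U k i` are
literally `Hⁱ(imGS P U, (coeffGSO S P θ k)|)` (`levelCohO_eq`), so the tree's all-degree Shapiro isomorphism of the permutation model
`sh = (coeffGSO S P θ k).shapiroCoindFinAddEquiv (imGS P U) _ i : Hⁱ(G_S, Maps(G_S ⧸ imGS P U, X_k)) ≃+ levelCohO S P θ U k i` applies on the nose: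
* §1 LOCAL INSTANCES for this file only (total disconnectedness of `G_S`, `Fintype` on the finite quotients `G_S ⧸ imGS P (layer)`, normality of the images of the
  layer groups, finiteness of the coefficients) and ★ `shO S P θ hU k i` (the Shapiro isomorphism in honda's currency);
* §2 ★ `shO_coindFinSum` — `sh (Hⁱ(Σ_{U'→U}) y) = relCoresO … (sh y)` (tree `shapiroCoindFinAddEquiv_cohomologyMap_coindFinSum`; `relCoresO` IS `relCor` by `rfl`);
  ★ `shO_rTransHom_one/_two` — `sh (Hⁱ(R_{π γ}) y) = levelConjO … γ (sh y)` (`i = 1, 2`; tree `…_rTransHom_one/_two`); ★ `shO_coindFinMap` — `sh (Hⁱ(Maps(f)) y) =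
  Hⁱ(levelMapHomO f) (sh y)` for every equivariant coefficient map `f` (tree `…_cohomologyMap_coindFinMap`), whence `shO_red` (`levelRedO`) and `shO_scalar` (`levelScalarO`).
Brick (δ-d3) reads the generic connecting map `dPerm` (brick (δ-c)) through `shO` as `d_{n,k} : H¹(K^{(1)}_m, X_k) → H²(K̃_n, X_k)`.
DEFINITIONS WITH BODIES (instance recipes, `shO`) + THEOREMS (`--supports stmt-BirchSwinnertonDyer-23599` helper); no named fact, no `sorry`; crux L, crux M, E2 and
BSD remain OPEN and are proved for NO curve by any of this.
References: [JohnsonLeungKings2011] §4.2 Def. 4.2 (94) (arXiv p0012:L80–112); [SerreGaloisCohomology1997] I §2.5; [NeukirchSchmidtWingberg2008] I §5 (1.5.3)–(1.5.4), I §6 (1.6.4)–(1.6.5);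
[SerreLocalFields1979] VII §5–§6.
-/

set_option autoImplicit false
-- the Theorems namespace of this sub repeats the summit name by design (D-0017 nested layout)
set_option linter.dupNamespace false

noncomputable section

open scoped NumberField
open CategoryTheory Field IsDedekindDomain
open Literature.NumberTheory.GaloisRepresentations
open Literature.NumberTheory.EllipticCurves
open Literature.NumberTheory.ComplexMultiplication.EllipticUnits.JohnsonLeungKings2011

namespace Summit.BirchSwinnertonDyer.BirchSwinnertonDyer.Theorems.SmallImageRttD2J2Delta

variable {K : Type} [Field K] [NumberField K] {p : ℕ} [Fact p.Prime] (S : Set (PadicAlgCl p)) (P : Set (HeightOneSpectrum (𝓞 K)))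
  (θ : absoluteGaloisGroup K →ₜ* (padicCoeffIntegers S)ˣ)

/-! ## §1 Instance recipes (local to the descent files) and the Shapiro isomorphism `shO` -/

omit [NumberField K] in
/-- `G_S` is totally disconnected (profinite). [cite: SerreGaloisCohomology1997, I §1.1] -/
theorem totallyDisconnectedSpace_GS : TotallyDisconnectedSpace (GaloisGroupUnramifiedOutside K P) := by
  haveI : CompactSpace (absoluteGaloisGroup K) := absoluteGaloisGroup_compactSpace K
  exact Literature.GroupTheory.ProfiniteSubquotients.totallyDisconnectedSpace_quotient (ramificationSubgroup K P) (ramificationSubgroup_isClosed K P)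

omit [NumberField K] in
/-- `Fintype` on `G_S ⧸ Ū_n`. [cite: JohnsonLeungKings2011, §2.1 (arXiv p0006:L10–12)] -/
@[reducible] def fintypeQuotLayer (κ : ZpExtension K p) (n : ℕ) : Fintype (GaloisGroupUnramifiedOutside K P ⧸ imGS P (κ.layerSubgroup n)) :=
  quotFintype P (κ.isOpen_layerSubgroup n)

omit [NumberField K] in
/-- `Fintype` on `G_S ⧸ V̄_n`. [cite: JohnsonLeungKings2011, §2.1 (arXiv p0006:L10–12)] -/
@[reducible] def fintypeQuotPairLayer (κ₁ κ₂ : ZpExtension K p) (n : ℕ) :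
    Fintype (GaloisGroupUnramifiedOutside K P ⧸ imGS P (pairLayerSubgroup κ₁ κ₂ n)) :=
  quotFintype P (isOpen_pairLayerSubgroup κ₁ κ₂ n)

omit [NumberField K] in
/-- `Fintype` on `G_S ⧸ (V̄_n ⊓ Ū_m)`. [cite: JohnsonLeungKings2011, §2.1 (arXiv p0006:L10–12)] -/
@[reducible] def fintypeQuotPairInfLayer (κ₁ κ₂ : ZpExtension K p) (n m : ℕ) :
    Fintype (GaloisGroupUnramifiedOutside K P ⧸ (imGS P (pairLayerSubgroup κ₁ κ₂ n) ⊓ imGS P (κ₁.layerSubgroup m))) :=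
  @Fintype.ofFinite _ (by
    haveI : CompactSpace (absoluteGaloisGroup K) := absoluteGaloisGroup_compactSpace K
    haveI := finiteIndex_imGS' P (isOpen_pairLayerSubgroup κ₁ κ₂ n)
    haveI := finiteIndex_imGS' P (κ₁.isOpen_layerSubgroup m)
    exact Subgroup.finite_quotient_of_finiteIndex)

attribute [local instance] totallyDisconnectedSpace_GS normal_imGS fintypeQuotLayer fintypeQuotPairLayer fintypeQuotPairInfLayer

/-- ★ **The Shapiro isomorphism in honda's currency**: `sh : Hⁱ(G_S, Maps(G_S ⧸ imGS P U, X_k)) ≃+ levelCohO S P θ U k i = Hⁱ(G_S(F), 𝒪 ⊗ μ_{p^k} ⊗ θ)` for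
`U = Gal(K̄/F)` open (tree `shapiroCoindFinAddEquiv`; `levelCohO_eq`). [cite: SerreGaloisCohomology1997, I §2.5 Prop. 10] [cite: JohnsonLeungKings2011, Def. 4.2 (94) (arXiv p0012:L94)] -/
def shO {U : Subgroup (absoluteGaloisGroup K)} (hU : IsOpen (U : Set (absoluteGaloisGroup K))) (k i : ℕ) :
    (continuousCohomology i (coindFin.{0, 0} (coeffGSO S P θ k).toTopRep (imGS P U)) : Type) ≃+ levelCohO S P θ U k i :=
  (coeffGSO S P θ k).shapiroCoindFinAddEquiv (imGS P U) (isOpen_imGS_of_isOpen P hU) i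

/-! ## §2 The dictionary -/

section Dictionary

variable {U U' : Subgroup (absoluteGaloisGroup K)} (h : U' ≤ U) (hU : IsOpen (U : Set (absoluteGaloisGroup K))) (hU' : IsOpen (U' : Set (absoluteGaloisGroup K)))

/-- ★ **Fibre sum ↦ corestriction**: `sh_U (Hⁱ(Σ_{U'→U}) y) = relCoresO S P θ h hU hU' k i (sh_{U'} y)` for open NORMAL `U' ≤ U` (`relCoresO` is the tree's `relCor` definitionally).
[cite: SerreGaloisCohomology1997, I §2.5] [cite: NeukirchSchmidtWingberg2008, I §5 Prop. (1.5.3), I §6 Prop. (1.6.4)] -/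
theorem shO_coindFinSum [U.Normal] [U'.Normal] (k i : ℕ) [Fintype (GaloisGroupUnramifiedOutside K P ⧸ imGS P U')]
    (y : continuousCohomology i (coindFin.{0, 0} (coeffGSO S P θ k).toTopRep (imGS P U'))) :
    shO S P θ hU k i (cohomologyMap (coindFinSum (coeffGSO S P θ k).toTopRep (imGS_le_of_le P h)) i y) = relCoresO S P θ h hU hU' k i (shO S P θ hU' k i y) := by
  haveI : IsClosed (imGS P U : Set (GaloisGroupUnramifiedOutside K P)) := isClosed_imGS' _ hU
  haveI : IsClosed (imGS P U' : Set (GaloisGroupUnramifiedOutside K P)) := isClosed_imGS' _ hU'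
  haveI : CompactSpace (absoluteGaloisGroup K) := absoluteGaloisGroup_compactSpace K
  haveI : ((imGS P U').subgroupOf (imGS P U)).FiniteIndex := by
    haveI := finiteIndex_imGS' P hU'
    infer_instance
  letI : Fintype (↥(imGS P U) ⧸ (imGS P U').subgroupOf (imGS P U)) := Fintype.ofFinite _
  exact (coeffGSO S P θ k).shapiroCoindFinAddEquiv_cohomologyMap_coindFinSum (imGS_le_of_le P h) (isOpen_imGS_of_isOpen P hU)
    (isOpen_imGS_of_isOpen P hU') i y

/-- ★ **Right translation ↦ conjugation, degree 1**: `sh_U (H¹(R_{π γ}) y) = levelConjO S P θ U k 1 γ (sh_U y)`. [cite: SerreLocalFields1979, VII §5] [cite: NeukirchSchmidtWingberg2008, I §6 Prop. (1.6.5)] -/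
theorem shO_rTransHom_one [U.Normal] (k : ℕ) (γ : absoluteGaloisGroup K) (y : continuousCohomology 1 (coindFin.{0, 0} (coeffGSO S P θ k).toTopRep (imGS P U))) :
    shO S P θ hU k 1 (cohomologyMap (rTransHom (coeffGSO S P θ k).toTopRep (imGS P U)
        (QuotientGroup.mk (toUnramifiedQuot K P γ) : GaloisGroupUnramifiedOutside K P ⧸ imGS P U)) 1 y) =
      levelConjO S P θ U k 1 γ (shO S P θ hU k 1 y) :=
  (coeffGSO S P θ k).shapiroCoindFinAddEquiv_rTransHom_one (imGS P U) (isOpen_imGS_of_isOpen P hU) (toUnramifiedQuot K P γ) y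

/-- ★ **Right translation ↦ conjugation, degree 2**: `sh_U (H²(R_{π γ}) y) = levelConjO S P θ U k 2 γ (sh_U y)`. [cite: SerreLocalFields1979, VII §5] [cite: NeukirchSchmidtWingberg2008, I §6 Prop. (1.6.5)] -/
theorem shO_rTransHom_two [U.Normal] (k : ℕ) (γ : absoluteGaloisGroup K) (y : continuousCohomology 2 (coindFin.{0, 0} (coeffGSO S P θ k).toTopRep (imGS P U))) :
    shO S P θ hU k 2 (cohomologyMap (rTransHom (coeffGSO S P θ k).toTopRep (imGS P U)
        (QuotientGroup.mk (toUnramifiedQuot K P γ) : GaloisGroupUnramifiedOutside K P ⧸ imGS P U)) 2 y) =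
      levelConjO S P θ U k 2 γ (shO S P θ hU k 2 y) :=
  (coeffGSO S P θ k).shapiroCoindFinAddEquiv_rTransHom_two (imGS P U) (isOpen_imGS_of_isOpen P hU) (toUnramifiedQuot K P γ) y

/-- ★ **Coefficient map ↦ `Hⁱ(levelMapHomO)`**: for every `Γ_K`-equivariant additive `f : 𝒪 ⊗ μ_{p^k} ⊗ θ → 𝒪 ⊗ μ_{p^{k'}} ⊗ θ`,
`sh_U (Hⁱ(Maps(G_S ⧸ U_S, f)) y) = Hⁱ(levelMapHomO f) (sh_U y)`. [cite: SerreLocalFields1979, VII §6] [cite: NeukirchSchmidtWingberg2008, I §6 Prop. (1.6.4)–(1.6.5)] -/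
theorem shO_coindFinMap {k k' : ℕ} (i : ℕ) (f : OMuCarrier K S (p ^ k) →+ OMuCarrier K S (p ^ k'))
    (hf : ∀ (σ : absoluteGaloisGroup K) (x : OMuCarrier K S (p ^ k)), f (muTwistO S θ k σ x) = muTwistO S θ k' σ (f x))
    (y : continuousCohomology i (coindFin.{0, 0} (coeffGSO S P θ k).toTopRep (imGS P U))) :
    shO S P θ hU k' i (cohomologyMap (coindFinMap (coeffMapHomO S P θ f hf) (imGS P U)) i y) =
      (ContinuousCohomology.map (ContinuousMonoidHom.id _) (levelMapHomO S P θ U f hf) i).hom (shO S P θ hU k i y) :=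
  ContinuousRep.shapiroCoindFinAddEquiv_cohomologyMap_coindFinMap (ρ := coeffGSO S P θ k) (ρ' := coeffGSO S P θ k') (N := imGS P U)
    (hN := isOpen_imGS_of_isOpen P hU) (f := coeffMapHomO S P θ f hf) (n := i) (y := y)

/-- **Reduction**: `sh_U (Hⁱ(Maps(red)) y) = levelRedO S P θ U k i (sh_U y)`. [cite: Kato2004Asterisque, §8.2 (p. 180)] -/
theorem shO_red (k i : ℕ) (y : continuousCohomology i (coindFin.{0, 0} (coeffGSO S P θ (k + 1)).toTopRep (imGS P U))) :
    shO S P θ hU k i (cohomologyMap (coindFinMap (coeffMapHomO S P θ (oMuRed S k) (oMuRed_muTwistO S θ k)) (imGS P U)) i y) =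
      levelRedO S P θ U k i (shO S P θ hU (k + 1) i y) :=
  shO_coindFinMap S P θ hU i (oMuRed S k) (oMuRed_muTwistO S θ k) y

/-- **Coefficient multiplication**: `sh_U (Hⁱ(Maps(c ⊗ id)) y) = levelScalarO S P θ U k i c (sh_U y)`. [cite: JohnsonLeungKings2011, §4.1 Def. 4.1 (arXiv p0012:L59–60)] -/
theorem shO_scalar (k i : ℕ) (c : padicCoeffIntegers S) (y : continuousCohomology i (coindFin.{0, 0} (coeffGSO S P θ k).toTopRep (imGS P U))) :
    shO S P θ hU k i (cohomologyMap (coindFinMap (coeffMapHomO S P θ (oMuScalar S (p ^ k) c) (oMuScalar_muTwistO S θ k c)) (imGS P U)) i y) =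
      levelScalarO S P θ U k i c (shO S P θ hU k i y) :=
  shO_coindFinMap S P θ hU i (oMuScalar S (p ^ k) c) (oMuScalar_muTwistO S θ k c) y

end Dictionary

end Summit.BirchSwinnertonDyer.BirchSwinnertonDyer.Theorems.SmallImageRttD2J2Delta

end
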